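import Summits.BirchSwinnertonDyer.Rank1Residual.Additive.KummerDeuringModel
import Summits.BirchSwinnertonDyer.Rank1Residual.Additive.GordRamifiedOrdinaryLineHigher
import Summits.BirchSwinnertonDyer.Rank1Residual.Additive.RamifiedOrdinaryLineExponentTwo
import HarnessLib

/-!
# The inertia EXPONENT of the ramified ordinary line on a (G-ord) row is the semistability defect
# `e = semistabilityIndex W p` — for EVERY ramified ordinary line, `p ≥ 5`, every `e ∈ {2, 3, 4, 6}`
# (cell `b2b-bsdres`, team n1011, seat p07 (gen 7); row T-ROL-EXP FILE B; the `n = e` supply for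
# cc-typer-2's model-free line matching S3 `RamifiedOrdinaryLineMatchingModelFree`)

HONEST FRAMING (cell `b2b-bsdres`, run/shared/lean/b2b/bsd-rank1-residual/, verbatim in every
file): the goal of the cell is to DELETE the COMBINATION-SHAPED residual classes of the
Birch–Swinnerton-Dyer formula for ALL analytic-rank `≤ 1` elliptic curves over `ℚ` — "full BSD
formula for every rank `≤ 1` curve in class `C`" assembled STRICTLY from published theorems — so
that the rank-`≤ 1` remainder becomes exactly the CONSTRUCTION-SHAPED classes, which are TYPED
(missing-input `Prop`s), NOT attempted. This is not "finishing BSD". Team n1011 (N10/N11): research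
route on the CONSTRUCTION-SHAPED classes X3♯(G-ord)/X4♯(G-ord); prove what is provable now; no
claim beyond stated classes; census output = EVIDENCE, never a Literature fact; RESIDUAL-MAP marks
UNCHANGED; nothing is booked by this file. TOOL theorems only: NO definition, NO named fact, NO
conjecture node; 0 hypotheses beyond `TypeGOrd`, `Addv`, `5 ≤ p`, `p ∈ v` and the line itself.

## What and why

cc-typer-1's `IsRamifiedOrdinaryLine W p L` says inertia acts on `E[p^∞]/C` through SOME finite
exponent; p05's T-ROL-G (F-A3 `exists_pos_forall_inertia_pow_smul_sub_mem_plus`) obtains it from the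
Krull topology, non-explicitly. cc-typer-2's S3 (`IsRamifiedOrdinaryLine.inclusion_mem_iff_of_not_dvd_lcm`,
`exists_lines_matching_of_not_dvd_lcm`) needs it EXPLICITLY: matching of the lines under an
`E₁[p] ≃ E₂[p]` is automatic when `¬ (p−1) ∣ lcm(n₁, n₂)`. This file proves that on a (G-ord) row at
`p ≥ 5` the exponent is the census's semistability defect `e = 12/gcd(12, ord_pΔ_min) ∈ {2,3,4,6}`:

* §1 (generic, p05's F-A setting) `pow_smul_sub_mem_plus_of_map_pow_eq` — if `σⁿ` FIXES the change
  of variables `C` of a good model for every inertial `σ`, then `σⁿ m − m ∈ C` for every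
  `m ∈ E[p^∞]` (F-A3 §1's argument with the Krull exponent replaced by the hypothesis; F-A1
  `goodReductionHom_pointEquiv_map_eq_of_map_eq`);
* §2 `exists_isRamifiedOrdinaryLine_and_pow_semistabilityIndex` (generic: `ord_p j ≥ 0`,
  `e ∣ p − 1`, `e ≠ 1, 2`, bad at `v` — every binder explicit) and its (G-ord) wrapper
  `…_of_typeGOrd_of_ne_two` — with FILE A2's EXPLICIT Kummer–Deuring model (`exists_kummerGoodModel`:
  `σ^e` fixes `C`) and p05's F-C2 assembly verbatim (ordinary point by F-B from `j̃ ∈ {0, 1728}`, F-A3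
  `isRamifiedOrdinaryLine_of_goodModel`): SOME ramified ordinary line has exponent `e` — a second,
  explicit-model existence proof of p05's F-C2 line, used only to read the exponent;
* §3 by cc-typer-2's model-free UNIQUENESS (`IsRamifiedOrdinaryLine.eq_of_isRamifiedOrdinaryLine`):
  **`IsRamifiedOrdinaryLine.pow_semistabilityIndex_smul_sub_mem`** — EVERY ramified ordinary line of a
  (G-ord) curve at `p ≥ 5` has exponent `e` (`e = 2` from FILE B0), and the class forms
  `ClassX4Gord/ClassX3Gord.pow_semistabilityIndex_smul_sub_mem_of_isRamifiedOrdinaryLine`.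

HONEST LIMIT (skeleton §5, cc-typer-2 S3 SCOPE): `e` is an UPPER bound for the order of the
quotient character (it IS the order — Serre 1972 §5.6 — but only "`σ^e` acts trivially" is proved);
links with `(p−1) ∣ lcm(e₁, e₂)` are not certified by exponents (the cell's located gap
`κ_{p^{1/e}}|_{I_v} = ω^{(p−1)/e}`).

References: J.-P. Serre, J. Tate, Ann. of Math. 88 (1968) §2 Thm. 2, Cor. 2 [SerreTate1968];
J.-P. Serre, Invent. Math. 15 (1972) §5.6 [Serre1972]; J. H. Silverman, *AEC* VII.5.5
[SilvermanAEC2009]; M. Emerton, R. Pollack, T. Weston, Invent. Math. 163 (2006) §3.1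
[EmertonPollackWeston2006]; R. Greenberg, V. Vatsal, Invent. Math. 142 (2000) §2 p. 26
[GreenbergVatsal2000]; cells/n1011/skel/T-ROL-EXP.md (67779f27699eb635); HOME/INBOX.md
2026-08-21T15:47Z / 16:14Z (cc-typer-2 S3, p287571 / p288081).
-/

set_option autoImplicit false

noncomputable section

open scoped Classical NNReal NumberField

open WeierstrassCurve

universe u

namespace Summit.BirchSwinnertonDyer.Rank1Residual.Additive.GoodModelLine

open NumberField IsDedekindDomain Field IsDedekindDomain.HeightOneSpectrum
  Literature.NumberTheory.GaloisRepresentations Literature.NumberTheory.EllipticCurves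
  Literature.NumberTheory.EllipticCurves.GreenbergSelmer
  Literature.NumberTheory.EllipticCurves.EmertonPollackWeston2006
  Literature.NumberTheory.EllipticCurves.Rank1Residual
  Literature.NumberTheory.EllipticCurves.Rank1Residual.Typed
  Summit.BirchSwinnertonDyer.Rank1Residual.X2.GreenbergVatsalReductionDatum

/-! ## §1 A good model whose change of variables is fixed by `σⁿ` has exponent `n` -/

section Generic

variable (W : WeierstrassCurve ℚ) [W.IsElliptic] (p : ℕ) [hp : Fact p.Prime]
  {v : HeightOneSpectrum (𝓞 ℚ)}
  {C : VariableChange (AlgebraicClosure (v.adicCompletion ℚ))}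
  {W₀ : WeierstrassCurve (specVal v).integer}
  (hW₀ : C • (W.baseChange (v.adicCompletion ℚ)).baseChange (AlgebraicClosure (v.adicCompletion ℚ)) =
    W₀.baseChange (AlgebraicClosure (v.adicCompletion ℚ)))
  (hΔ : IsUnit W₀.Δ)
  (red : localPoints W (v.adicCompletion ℚ) →+
    (W₀.map (IsLocalRing.residue (specVal v).integer)).toAffine.Point)
  (hred : ∀ P, red P = goodReductionHom W₀ (Valuation.integer.integers (specVal v)) hΔ
    (Affine.Point.congrEquiv hW₀ (VariableChange.pointEquiv _ C
      (Affine.Point.congrEquiv (baseChange_baseChange_adicCompletion W v).symm P))))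
  (Lv : LocalDatum ℚ (W.geomPrimaryTorsion p) v)
  (hLv : ∀ m, m ∈ Lv.plus ↔ red (pointsMap W (v.adicCompletion ℚ) (m : W.geomPoints)) = 0)

omit [W.IsElliptic] hp in
include hred hLv in
/-- **Exponent from a fixed model.** In p05's F-A setting (a good model `W₀ = C • E ⊗ K̄_v` over
`𝒪_w`, the datum `Lv` with `m ∈ C ↔ red_{W₀}(Φ_C(ι m)) = 0`): if `σⁿ` FIXES `C` for every local
inertia element `σ`, then `σⁿ m − m ∈ C` for every `m ∈ E[p^∞]` — `σⁿ` is an inertial isometry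
fixing the good model, so it does not change reductions (F-A1
`goodReductionHom_pointEquiv_map_eq_of_map_eq`). F-A3 §1's argument with the Krull exponent replaced
by the hypothesis `hC`. [cite: SerreTate1968, §2 Thm. 2 and Cor. 2] [cite: SilvermanAEC2009, Prop. VII.2.1] -/
theorem pow_smul_sub_mem_plus_of_map_pow_eq (n : ℕ)
    (hC : ∀ σ ∈ absInertia (v.adicCompletion ℚ),
      C.map ((absoluteGaloisGroup.toAlgEquiv _ (σ ^ n) :
        AlgebraicClosure (v.adicCompletion ℚ) ≃ₐ[v.adicCompletion ℚ]
          AlgebraicClosure (v.adicCompletion ℚ)) :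
        AlgebraicClosure (v.adicCompletion ℚ) →+* AlgebraicClosure (v.adicCompletion ℚ)) = C) :
    ∀ σ ∈ absInertia (v.adicCompletion ℚ), ∀ m : W.geomPrimaryTorsion p,
      (absGaloisRestrict ℚ (v.adicCompletion ℚ) σ) ^ n • m - m ∈ Lv.plus := by
  obtain ⟨𝔐, h𝔐⟩ := v.localPrimesAbove_nonempty
  intro σ hσ m
  set τ : absoluteGaloisGroup (v.adicCompletion ℚ) := σ ^ n with hτ
  have hτI : τ ∈ absInertia (v.adicCompletion ℚ) := Subgroup.pow_mem _ hσ n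
  have hτI' : τ ∈ 𝔐.inertia (absoluteGaloisGroup (v.adicCompletion ℚ)) := by
    rw [inertia_eq_absInertia (specVal_spec v) h𝔐]; exact hτI
  have hmove := (mem_inertia_iff_spectralValuation (specVal_spec v) h𝔐).1 hτI'
  rw [hLv, ← map_pow, ← hτ, AddSubgroupClass.coe_sub, primaryComponent.coe_smul, map_sub,
    pointsMap_absGaloisRestrict_smul, map_sub, sub_eq_zero, hred, hred, congrEquiv_smul W v τ]
  exact goodReductionHom_pointEquiv_map_eq_of_map_eq (W.baseChange (v.adicCompletion ℚ)) C hW₀ hΔ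
    (absoluteGaloisGroup.toAlgEquiv _ τ) (fun z ↦ spectralValuation_smul (specVal_spec v) τ z)
    hmove (hC σ hσ) _

end Generic

/-! ## §2 On a (G-ord) row with `e ≠ 2`: a ramified ordinary line with exponent `e` -/

section Gord

variable (W : WeierstrassCurve ℚ) [W.IsElliptic] [W.IsGloballyMinimal] (p : ℕ) [hp : Fact p.Prime]
  {v : HeightOneSpectrum (𝓞 ℚ)}

set_option maxHeartbeats 400000 in -- `hred` by `rfl` through three transports (as in F-A3)
/-- **A ramified ordinary line WITH EXPONENT `e` from the explicit model — generic form, every binder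
explicit** (`p ≥ 5`, `v ∋ p`, `ord_p j ≥ 0`, `e = semistabilityIndex W p` with `e ∣ p − 1`, `e ≠ 1`,
`e ≠ 2`, and `E` BAD at `v`): FILE A2's Kummer–Deuring model (`exists_kummerGoodModel`: `σ^e` fixes
`C`), the ordinary point by F-B (`3 ∣ e ⟹ j̃ = 0` via `residue_c₄_eq_zero_of_goodModel` and the
NAMED strictness lemma `semistabilityIndex_dvd_four_of_three_dvd`; `4 ∣ e ⟹ j̃ = 1728` likewise),
F-A3 `isRamifiedOrdinaryLine_of_goodModel`, and the exponent clause from §1. p05's F-C2 proof re-run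
on the explicit model. [cite: SerreTate1968, §2 Thm. 2 and Cor. 2]
[cite: SilvermanAEC2009, Prop. VII.5.5, Thm. V.4.1(a)]
[cite: EmertonPollackWeston2006, §3.1 (eq:ordes) (arXiv:math/0404484 p. 17)] -/
theorem exists_isRamifiedOrdinaryLine_and_pow_semistabilityIndex (hp5 : 5 ≤ p)
    (hpv : ((p : ℕ) : 𝓞 ℚ) ∈ v.asIdeal) (hj : 0 ≤ padicValRat p W.j)
    (hedvd : semistabilityIndex W p ∣ p - 1) (he1 : semistabilityIndex W p ≠ 1)
    (he : semistabilityIndex W p ≠ 2) (hbad : ¬ W.HasGoodReductionAt v) :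
    ∃ Lv : LocalDatum ℚ (W.geomPrimaryTorsion p) v, IsRamifiedOrdinaryLine W p Lv ∧
      ∀ σ ∈ absInertia (v.adicCompletion ℚ), ∀ m : W.geomPrimaryTorsion p,
        (absGaloisRestrict ℚ (v.adicCompletion ℚ) σ) ^ semistabilityIndex W p • m - m ∈ Lv.plus := by
  have he12 := semistabilityIndex_dvd_twelve W p
  have hecase : semistabilityIndex W p = 3 ∨ semistabilityIndex W p = 4 ∨ semistabilityIndex W p = 6 ∨
      semistabilityIndex W p = 12 := by
    have hle : semistabilityIndex W p ≤ 12 := Nat.le_of_dvd (by norm_num) he12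
    interval_cases h : semistabilityIndex W p <;> omega
  -- the EXPLICIT good model
  obtain ⟨C, W₀, hW₀, hΔ, hCfix⟩ := exists_kummerGoodModel p W hp5 hpv hj
  haveI := charP_residueField_specVal p hpv
  -- the ordinary point (verbatim from F-C2)
  have hord : ∃ P : (W₀.baseChange (AlgebraicClosure (v.adicCompletion ℚ))).toAffine.Point,
      (p : ℤ) • P = 0 ∧ goodReductionHom W₀ (Valuation.integer.integers (specVal v)) hΔ P ≠ 0 := by
    by_cases h3e : 3 ∣ semistabilityIndex W p
    · have h3v : ¬ 3 ∣ padicValInt p W.minimalDiscriminantInt := by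
        intro h
        have : 3 ∣ 4 := dvd_trans h3e (semistabilityIndex_dvd_four_of_three_dvd W p h)
        omega
      exact exists_torsion_goodReductionHom_ne_zero_of_residue_c₄_eq_zero
        (O := (specVal v).valuationSubring) (Valuation.integer.integers (specVal v)) hΔ p hp5
        (dvd_trans h3e hedvd)
        (residue_c₄_eq_zero_of_goodModel W p hpv hW₀ hΔ
          (j_eq_zero_or_padicValRat_j_pos_of_not_three_dvd W p hj h3v))
    · have h4e : 4 ∣ semistabilityIndex W p := by
        rcases hecase with h | h | h | h <;> rw [h] at h3e ⊢ <;> omega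
      have h2v : ¬ 2 ∣ padicValInt p W.minimalDiscriminantInt := by
        intro h
        have : 4 ∣ 6 := dvd_trans h4e (semistabilityIndex_dvd_six_of_two_dvd W p h)
        omega
      exact exists_torsion_goodReductionHom_ne_zero_of_residue_c₆_eq_zero
        (O := (specVal v).valuationSubring) (Valuation.integer.integers (specVal v)) hΔ p hp5
        (dvd_trans h4e hedvd)
        (residue_c₆_eq_zero_of_goodModel W p hpv hW₀ hΔ
          (j_eq_or_padicValRat_j_sub_pos_of_not_two_dvd W p hp5 hj h2v))
  -- the datum with its reduction map (as in F-A3 `exists_isRamifiedOrdinaryLine_of_goodModel`)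
  let Φ₁ : localPoints W (v.adicCompletion ℚ) ≃+
      ((W.baseChange (v.adicCompletion ℚ)).baseChange (AlgebraicClosure (v.adicCompletion ℚ))).toAffine.Point :=
    Affine.Point.congrEquiv (baseChange_baseChange_adicCompletion W v).symm
  let Φ : localPoints W (v.adicCompletion ℚ) ≃+
      (W₀.baseChange (AlgebraicClosure (v.adicCompletion ℚ))).toAffine.Point :=
    (Φ₁.trans (VariableChange.pointEquiv _ C)).trans (Affine.Point.congrEquiv hW₀)
  let red : localPoints W (v.adicCompletion ℚ) →+
      (W₀.map (IsLocalRing.residue (specVal v).integer)).toAffine.Point :=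
    (goodReductionHom W₀ (Valuation.integer.integers (specVal v)) hΔ).comp Φ.toAddMonoidHom
  have hred : ∀ P, red P = goodReductionHom W₀ (Valuation.integer.integers (specVal v)) hΔ
      (Affine.Point.congrEquiv hW₀ (VariableChange.pointEquiv _ C
        (Affine.Point.congrEquiv (baseChange_baseChange_adicCompletion W v).symm P))) := fun _ ↦ rfl
  obtain ⟨Lv, hLv⟩ := exists_localDatum_mem_iff_red_eq_zero W p hW₀ hΔ red hred
  exact ⟨Lv, isRamifiedOrdinaryLine_of_goodModel W p hW₀ hΔ red hred hord Lv hLv hpv hbad,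
    pow_smul_sub_mem_plus_of_map_pow_eq W p hW₀ hΔ red hred Lv hLv (semistabilityIndex W p) hCfix⟩

/-- **On a (G-ord) row with `e ≠ 2` (`p ≥ 5`): a ramified ordinary line with exponent `e`** — the
binders of the generic form discharged from `TypeGOrd W p ∧ Addv W p`: `ord_p j ≥ 0` and `e ∣ p − 1`
(additive-p2's `typeG_iff_not_subM_and_semistabilityIndex_dvd`), `e ≠ 1`
(`semistabilityIndex_ne_one_of_addv`), bad at `v` (`hasAdditiveReductionAt_of_addv`).
[cite: SerreTate1968, §2 Thm. 2 and Cor. 2] [cite: EmertonPollackWeston2006, §3.1 (eq:ordes) (arXiv:math/0404484 p. 17)] -/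
theorem exists_isRamifiedOrdinaryLine_and_pow_semistabilityIndex_of_typeGOrd_of_ne_two (hp5 : 5 ≤ p)
    (hG : TypeGOrd W p) (hadd : Addv W p) (he : semistabilityIndex W p ≠ 2)
    (hpv : ((p : ℕ) : 𝓞 ℚ) ∈ v.asIdeal) :
    ∃ Lv : LocalDatum ℚ (W.geomPrimaryTorsion p) v, IsRamifiedOrdinaryLine W p Lv ∧
      ∀ σ ∈ absInertia (v.adicCompletion ℚ), ∀ m : W.geomPrimaryTorsion p,
        (absGaloisRestrict ℚ (v.adicCompletion ℚ) σ) ^ semistabilityIndex W p • m - m ∈ Lv.plus := by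
  have hj : 0 ≤ padicValRat p W.j := padicValRat_j_nonneg_of_typeGOrd W p hG
  have hedvd : semistabilityIndex W p ∣ p - 1 :=
    ((typeG_iff_not_subM_and_semistabilityIndex_dvd W p hp5).mp hG.typeG).2
  have he1 := semistabilityIndex_ne_one_of_addv W p hp5 hadd hj
  have hbad : ¬ W.HasGoodReductionAt v := by
    rw [eq_primesEquiv_symm p hpv]
    exact (hasAdditiveReductionAt_of_addv W p hadd).not_hasGoodReductionAt
  exact exists_isRamifiedOrdinaryLine_and_pow_semistabilityIndex W p hp5 hpv hj hedvd he1 he hbad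

end Gord

end Summit.BirchSwinnertonDyer.Rank1Residual.Additive.GoodModelLine

/-! ## §3 EVERY ramified ordinary line on a (G-ord) row has exponent `e` (uniqueness) -/

namespace Literature.NumberTheory.EllipticCurves.EmertonPollackWeston2006.IsRamifiedOrdinaryLine

open NumberField IsDedekindDomain Field IsDedekindDomain.HeightOneSpectrum WeierstrassCurve
  Literature.NumberTheory.GaloisRepresentations Literature.NumberTheory.EllipticCurves
  Literature.NumberTheory.EllipticCurves.GreenbergSelmer
  Literature.NumberTheory.EllipticCurves.Rank1Residual
  Summit.BirchSwinnertonDyer.Rank1Residual.Additive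
  Summit.BirchSwinnertonDyer.Rank1Residual.Additive.GoodModelLine

variable {W : WeierstrassCurve ℚ} [W.IsElliptic] [W.IsGloballyMinimal] {p : ℕ} [hp : Fact p.Prime]
  {v : HeightOneSpectrum (𝓞 ℚ)}

/-- **THE INERTIA EXPONENT OF THE RAMIFIED ORDINARY LINE IS THE SEMISTABILITY DEFECT** (`p ≥ 5`,
every `e ∈ {2, 3, 4, 6}`). For `E/ℚ` globally minimal, additive at `p` of type (G)-ordinary, and ANY
ramified ordinary line `L` of `E` at `v ∋ p`: every local inertia element `σ` satisfies
`σ^e m − m ∈ C` for all `m ∈ E[p^∞]`, `e = semistabilityIndex W p = 12/gcd(12, ord_pΔ_min)`. By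
cc-typer-2's model-free uniqueness the given line IS the explicit-model line of §2 (`e ≠ 2`) or p10's
twisted Greenberg line (FILE B0, `e = 2`). The `hn` binder of cc-typer-2's S3
`inclusion_mem_iff_of_not_dvd_lcm` with `n := e`. NOT claimed: that `e` is the exact order (Serre 1972
§5.6) — only "`σ^e` acts trivially". [cite: SerreTate1968, §2 Thm. 2 and Cor. 2]
[cite: Serre1972, §5.6 (p. 312)] [cite: GreenbergVatsal2000, §2 p. 26]
[cite: EmertonPollackWeston2006, §3.1 (eq:ordes) (arXiv:math/0404484 p. 17)] -/
theorem pow_semistabilityIndex_smul_sub_mem (hp5 : 5 ≤ p) (hG : TypeGOrd W p) (hadd : Addv W p)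
    (hpv : ((p : ℕ) : 𝓞 ℚ) ∈ v.asIdeal) {L : LocalDatum ℚ (W.geomPrimaryTorsion p) v}
    (hL : IsRamifiedOrdinaryLine W p L) :
    ∀ σ ∈ absInertia (v.adicCompletion ℚ), ∀ m : W.geomPrimaryTorsion p,
      (absGaloisRestrict ℚ (v.adicCompletion ℚ) σ) ^ semistabilityIndex W p • m - m ∈ L.plus := by
  have hp2 : p ≠ 2 := by omega
  by_cases he : semistabilityIndex W p = 2
  · rw [he]
    exact sq_smul_sub_mem_of_typeGOrd_of_semistabilityIndex_eq_two hp2 hG hadd he hpv hL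
  · obtain ⟨L', hL', hpow⟩ :=
      exists_isRamifiedOrdinaryLine_and_pow_semistabilityIndex_of_typeGOrd_of_ne_two W p hp5 hG hadd he hpv
    rw [hL.eq_of_isRamifiedOrdinaryLine hL' hpv]
    exact hpow

end Literature.NumberTheory.EllipticCurves.EmertonPollackWeston2006.IsRamifiedOrdinaryLine

namespace Summit.BirchSwinnertonDyer.Rank1Residual.Additive

open NumberField IsDedekindDomain Field IsDedekindDomain.HeightOneSpectrum WeierstrassCurve
  Literature.NumberTheory.GaloisRepresentations Literature.NumberTheory.EllipticCurves
  Literature.NumberTheory.EllipticCurves.GreenbergSelmer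
  Literature.NumberTheory.EllipticCurves.EmertonPollackWeston2006
  Literature.NumberTheory.EllipticCurves.Rank1Residual

variable {W : WeierstrassCurve ℚ} [W.IsElliptic] [W.IsGloballyMinimal] {p : ℕ} [hp : Fact p.Prime]
  {v : HeightOneSpectrum (𝓞 ℚ)}

/-- **X4♯(G-ord), `p ≥ 5`, every defect: every ramified ordinary line has inertia exponent
`e = semistabilityIndex W p`.** X4♯(G-ord) stays CONSTRUCTION-SHAPED; nothing booked.
[cite: SerreTate1968, §2 Thm. 2 and Cor. 2] [cite: GreenbergVatsal2000, §2 p. 26] -/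
theorem ClassX4Gord.pow_semistabilityIndex_smul_sub_mem_of_isRamifiedOrdinaryLine (hX : ClassX4Gord W p)
    (hp5 : 5 ≤ p) (hpv : ((p : ℕ) : 𝓞 ℚ) ∈ v.asIdeal) {L : LocalDatum ℚ (W.geomPrimaryTorsion p) v}
    (hL : IsRamifiedOrdinaryLine W p L) :
    ∀ σ ∈ absInertia (v.adicCompletion ℚ), ∀ m : W.geomPrimaryTorsion p,
      (absGaloisRestrict ℚ (v.adicCompletion ℚ) σ) ^ semistabilityIndex W p • m - m ∈ L.plus :=
  hL.pow_semistabilityIndex_smul_sub_mem hp5 hX.typeGOrd hX.addv.2 hpv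

/-- **X3♯(G-ord), `p ≥ 5`, every defect: every ramified ordinary line has inertia exponent
`e = semistabilityIndex W p`.** X3♯(G-ord) stays CONSTRUCTION-SHAPED; nothing booked.
[cite: SerreTate1968, §2 Thm. 2 and Cor. 2] [cite: GreenbergVatsal2000, §2 p. 26] -/
theorem ClassX3Gord.pow_semistabilityIndex_smul_sub_mem_of_isRamifiedOrdinaryLine (hX : ClassX3Gord W p)
    (hp5 : 5 ≤ p) (hpv : ((p : ℕ) : 𝓞 ℚ) ∈ v.asIdeal) {L : LocalDatum ℚ (W.geomPrimaryTorsion p) v}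
    (hL : IsRamifiedOrdinaryLine W p L) :
    ∀ σ ∈ absInertia (v.adicCompletion ℚ), ∀ m : W.geomPrimaryTorsion p,
      (absGaloisRestrict ℚ (v.adicCompletion ℚ) σ) ^ semistabilityIndex W p • m - m ∈ L.plus :=
  hL.pow_semistabilityIndex_smul_sub_mem hp5 hX.typeGOrd hX.addv hpv

/-- **Existence WITH exponent, every (G-ord) row at `p ≥ 5`, every defect** — the pair
(`∃ L, IsRamifiedOrdinaryLine W p L`, exponent `e`) that cc-typer-2's `exists_lines_matching_of_not_dvd_lcm`
consumes on either member of a link (line: p05 F-C2 / p10; exponent: this file).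
[cite: EmertonPollackWeston2006, §3.1 (eq:ordes) (arXiv:math/0404484 p. 17)] [cite: SerreTate1968, §2 Thm. 2 and Cor. 2] -/
theorem exists_isRamifiedOrdinaryLine_and_pow_semistabilityIndex_of_typeGOrd (hp5 : 5 ≤ p)
    (hG : TypeGOrd W p) (hadd : Addv W p) (hpv : ((p : ℕ) : 𝓞 ℚ) ∈ v.asIdeal) :
    ∃ L : LocalDatum ℚ (W.geomPrimaryTorsion p) v, IsRamifiedOrdinaryLine W p L ∧
      ∀ σ ∈ absInertia (v.adicCompletion ℚ), ∀ m : W.geomPrimaryTorsion p,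
        (absGaloisRestrict ℚ (v.adicCompletion ℚ) σ) ^ semistabilityIndex W p • m - m ∈ L.plus := by
  have hp2 : p ≠ 2 := by omega
  by_cases he : semistabilityIndex W p = 2
  · obtain ⟨L, hL, hsq⟩ :=
      RamifiedOrdinaryLineExponentTwo.exists_isRamifiedOrdinaryLine_and_sq_of_typeGOrd hp2 hG hadd he hpv
    exact ⟨L, hL, by rw [he]; exact hsq⟩
  · exact GoodModelLine.exists_isRamifiedOrdinaryLine_and_pow_semistabilityIndex_of_typeGOrd_of_ne_two W p
      hp5 hG hadd he hpv

end Summit.BirchSwinnertonDyer.Rank1Residual.Additive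

end
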